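import Summits.CriticalPhenomena.PercolationContinuityZ3.Theorems.PercNearOneGluingNoHeavyLowerTailSahiCombPositivity
import Summits.CriticalPhenomena.PercolationContinuityZ3.Theorems.PercNearOneGluingNoHeavyLowerTailSahiAbsorbedMember

/-!
# Sahi's `E_{n+1}` with an ABSORBED member, III: the COMB (tensor-Bernstein) row — for product measures on cubes, an event inside all the others makes
# `p ↦ E_{n+1}(μ_p; 1_W, 1_{U_1}, …, 1_{U_n})` comb-positive of multidegree `n + 1`, for ARBITRARY (not necessarily increasing) events, EVERY order

Support file of the one-cut programme (crux `NoHeavyLowerTail`, stmt-CriticalPhenomena-4575; cell `prim-masterthm`, seat P3, gen 18; the comb hierarchy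
`run/shared/lean/prim/prim-masterthm/prim-masterthm-p3/HIERARCHY.md` §3–§4, §9, §26(e)).  Sequel of `…SahiAbsorbedMember{RForm,}` and of the comb framework
`…SahiCombPositivity` (`SahiComb.CombPos`, P3 gen 2).

By `SahiAbsorbed.sahiE_cons_eq_ex_mul_rform`, `E_{n+1}(1_W, 1_{U_1},…,1_{U_n}) = μ_p(W)·R_p(U)` and `R_p` obeys the block recursion
`R_p(C) = Σ_{B ∋ i} (|B|−1)!·(1 − μ_p(⋂_{j∈B} U_j))·R_p(C ∖ B)` (`rform_eq_sum_block`); each factor `1 − μ_p(⋂_B U)` is comb-positive of multidegree 1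
(`combPos_one_sub_ex_ind`) and multidegrees add, so:
* `combPos_rform` — `p ↦ R_p(C)` is comb-positive of multidegree `|C|` (strong induction on `C`);
* **`combPos_sahiE_cons_of_subset`** — for ARBITRARY events `W ⊆ U_j` (all `j`): `CombPos (n+1) (p ↦ E_{n+1}(μ_p; 1_W, 1_{U_1}, …, 1_{U_n}))` — an UNCONDITIONAL
  all-orders row of the comb table (no increasing hypothesis, no hypothesis on sub-families; compare gen 2's `combPos_sahiE_ind_of_totalMeet_local`, which needs the
  big member to CONTAIN the intersection and local comb hypotheses on the sub-families, and `combPos_sahiE_ind_of_triplewise` for towers/chains of increasing events).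
Everything proved; axioms standard. [this work]
-/

noncomputable section

open scoped Classical

namespace Summit.CriticalPhenomena.PercolationContinuityZ3.Theorems

open Finset Function
open Literature.Combinatorics.Sahi2008
open Literature.Probability.Percolation.DecisionTree (ind ind_of_mem ind_of_not_mem ind_nonneg)
open SahiComb

namespace SahiAbsorbed

variable {ι : Type} [Fintype ι] {n : ℕ}

omit [Fintype ι] in
/-- Indicator of an intersection over a finset of indices is the product of the indicators. [this work] -/
theorem prod_ind_eq_ind_iInter (U : Fin n → Set (Set ι)) (B : Finset (Fin n)) (ω : Set ι) :
    ∏ j ∈ B, ind (U j) ω = ind (⋂ j ∈ B, U j) ω := by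
  induction B using Finset.induction_on with
  | empty => simp [ind]
  | insert j B hj ih =>
    rw [prod_insert hj, ih]
    unfold ind
    by_cases h1 : ω ∈ U j <;> by_cases h2 : ω ∈ ⋂ k ∈ B, U k <;>
      simp [h1, h2]

/-- **`p ↦ R_p(C)` is comb-positive of multidegree `|C|`** for every family of events (the nonnegative block recursion, by strong induction). [this work] -/
theorem combPos_rform (U : Fin n → Set (Set ι)) (C : Finset (Fin n)) :
    CombPos (fun _ : ι => C.card) (fun p => rform (bernoulliWeight p) (fun j => ind (U j)) C) := by
  induction C using Finset.strongInduction with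
  | H C ih =>
    rcases C.eq_empty_or_nonempty with rfl | ⟨i, hi⟩
    · exact (combPos_const (fun _ : ι => (∅ : Finset (Fin n)).card) zero_le_one).congr fun p => rform_empty _ _
    · refine (CombPos.sum (C.powerset.filter fun B => i ∈ B) (F := fun B p =>
          (((B.card - 1).factorial : ℕ) : ℝ) * (1 - mom (bernoulliWeight p) (fun j => ind (U j)) B) *
            rform (bernoulliWeight p) (fun j => ind (U j)) (C \ B)) fun B hB => ?_).congr
        fun p => rform_eq_sum_block (bernoulliWeight p) (fun j => ind (U j)) hi
      rw [mem_filter, mem_powerset] at hB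
      have hsub : C \ B ⊂ C := sdiff_ssubset hB.1 ⟨i, hB.2⟩
      -- `1 − μ_p(⋂_B U)` is comb-positive of degree 1
      have h1 : CombPos (fun _ : ι => 1) (fun p => 1 - mom (bernoulliWeight p) (fun j => ind (U j)) B) := by
        refine (combPos_one_sub_ex_ind (⋂ j ∈ B, U j)).congr fun p => ?_
        unfold mom
        congr 2
        funext ω
        exact prod_ind_eq_ind_iInter U B ω
      have h2 := ih _ hsub
      have hdeg : (fun _ : ι => 1) + (fun _ : ι => (C \ B).card) ≤ fun _ : ι => C.card := by
        intro e
        simp only [Pi.add_apply]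
        have := card_sdiff_of_subset hB.1
        have hBpos : 0 < B.card := card_pos.2 ⟨i, hB.2⟩
        have hBle : B.card ≤ C.card := card_le_card hB.1
        omega
      have h12 := (CombPos.mul_of_le h1 h2 hdeg).smul (Nat.cast_nonneg ((B.card - 1).factorial))
      exact h12.congr fun p => by ring

/-- **THE COMB ROW OF THE ABSORBED FAMILY**: for every finite `ι`, every `n`, and ARBITRARY events `W, U_1, …, U_n ⊆ 2^ι` with `W ⊆ U_j` for all `j`, the map
`p ↦ E_{n+1}(μ_p; 1_W, 1_{U_1}, …, 1_{U_n})` is a nonnegative combination of the degree-`(n+1)` tensor-Bernstein basis on `[0,1]^ι`. [this work] -/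
theorem combPos_sahiE_cons_of_subset (W : Set (Set ι)) (U : Fin n → Set (Set ι)) (hW : ∀ j, W ⊆ U j) :
    CombPos (fun _ : ι => n + 1) (fun p => sahiE (bernoulliWeight p) (n + 1) (Fin.cons (ind W) (fun j => ind (U j)))) := by
  have habs : ∀ (j : Fin n) (ω : Set ι), ind W ω * ind (U j) ω = ind W ω := by
    intro j ω
    by_cases hω : ω ∈ W
    · rw [ind_of_mem hω, ind_of_mem (hW j hω)]; ring
    · rw [ind_of_not_mem hω]; ring
  have hR := combPos_rform U (univ : Finset (Fin n))
  have hWc := combPos_ex_ind W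
  have hdeg : (fun _ : ι => 1) + (fun _ : ι => (univ : Finset (Fin n)).card) ≤ fun _ : ι => n + 1 := by
    intro e; simp [Pi.add_apply, Finset.card_univ, Fintype.card_fin]; omega
  exact (CombPos.mul_of_le hWc hR hdeg).congr fun p => sahiE_cons_eq_ex_mul_rform (bernoulliWeight p) (ind W) (fun j => ind (U j)) habs

end SahiAbsorbed

end Summit.CriticalPhenomena.PercolationContinuityZ3.Theorems
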